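import Summits.CriticalPhenomena.PercolationContinuityZ3.Theorems.PercNearOneGluingNoHeavyLowerTailCILTwoGateTools
import Summits.CriticalPhenomena.PercolationContinuityZ3.Theorems.PercNearOneGluingNoHeavyLowerTailCILInductionStep
import HarnessLib

/-!
# `NoHeavyLowerTail` (stmt-CriticalPhenomena-4575) — the induction STEP for an observer set with at most TWO GATES

Support file (prover `prim-gen-induct`, blob-quotient / cumulative-isolation line, gen 3; `--supports
stmt-CriticalPhenomena-4575`).  No definitions, no named facts, no sorries.

Setting and notation as in `…CILSetStarTools` and `…CILInductionStep`: `μ = prodBernoulli w`, relays `A`, level `j`,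
observer set `S` (disjoint from `A`), `ξ(ω) = ω ∩ {e | ∀ v ∈ S, v ∉ e}` the configuration OFF `S` ("`K = H − S`"),
`~'` reachability in `ξ`, `I_K(x) = μ{|π'(x)| ≤ j}`, gates `Γ(ω)`, and
`CS_w(S, c) : μ(c ↮ S, 1 ≤ |π(S)| ≤ j) ≤ μ(c ↮ S, |π(c)| ≤ j)`.

HYPOTHESIS OF THIS FILE: every positive-weight pair leaving `S` ends in one of two vertices `y ≠ z` (`N(S) ⊆ {y, z}`;
`y, z` relays or not, pairs inside `S` arbitrary).  Then almost surely `Γ(ω) ⊆ {y, z}`, and the only effect of the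
edges meeting `S` on the clusters of the other vertices is whether they join `y` to `z` THROUGH `S`
(event `R = {y ~ z in ω ∩ {e | e meets S}}`, probability `θ`):

* `TwoGate.reach_iff` — for `a, b ∉ S`: `a ~ b` iff `a ~' b`, or `R` and `a ~' {y,z} ~' b` (walk induction);
* `TwoGate.gateEq_pair_of_R` — `R ⊆ {Γ = {y,z}}`, so `θ ≤ ρ := μ{Γ = {y,z}}`;
* `TwoGate.lightness_eq` — for a relay `x`: `I_w(x) = θ·G(x) + (1 − θ)·I_K(x)`, `G(x) = μ(x ≁' {y,z}, |π'(x)| ≤ j) +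
  μ(x ~' {y,z}, |π'({y,z})| ≤ j)` the lightness of `x` in `K` with `y, z` glued;
* `TwoGate.setCS_of_twoGate` — **THE STEP FOR TWO GATES**: if `c ∈ A` is a champion of `w` and set-champion stability
  in `K` holds at the observer sets `{y}`, `{z}`, `{y,z}` for every champion of `K`, then `CS_w(S, c)`.

PROOF OF THE STEP (crux notes BLOBQUOTIENT.md §20, "one-parameter gluing families are monotone").  By the flat expansion
(`SetStar.setL_eq_sum/setR_eq_sum`) `μ(RS) − μ(LS) = Σ_{Y ⊆ {y,z}} μ{Γ = Y}·Δ_K(Y, c)`.  Let `c₀` be a champion of `K`.  If `c`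
is itself a champion of `K`, every `Δ_K(Y, c) ≥ 0` by hypothesis.  Otherwise `d_K := I_K(c) − I_K(c₀) < 0`; the witness
shift `Δ_K(Y, c) = Δ_K(Y, c₀) + J^Y(c) − J^Y(c₀)` (with `J^{∅} = J^{{y}} = J^{{z}} = I_K`, `J^{{y,z}} = G`) and `Δ_K(Y, c₀) ≥ 0`
give `μ(RS) − μ(LS) ≥ (1 − ρ)·d_K + ρ·d_G`, `d_G := G(c) − G(c₀)`; the champion hypothesis `I_w(c₀) ≤ I_w(c)` reads
`(1 − θ)·d_K + θ·d_G ≥ 0`; since `d_K < 0` this forces `d_G ≥ d_K`, and `θ ≤ ρ` then gives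
`(1 − ρ)·d_K + ρ·d_G ≥ (1 − θ)·d_K + θ·d_G ≥ 0`.  No lightness of `S` and no bound on `|S|` is needed; for `|N(S)| ≥ 3`
the analogous single-reference-witness bound is false (crux notes §20 addendum), so two gates is the exact reach of
this argument.
-/

noncomputable section

namespace Summit.CriticalPhenomena.PercolationContinuityZ3.Theorems

open MeasureTheory Set Literature.Probability.LatticeModels Literature.Probability.Percolation
open scoped Classical BigOperators

variable {n : ℕ}

namespace CutObserver

namespace TwoGate

/-! ### The step for two gates -/

/-- **THE NON-ADJACENT INDUCTION STEP FOR AN OBSERVER SET WITH AT MOST TWO GATES.**  Let `S` be disjoint from the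
relays `A`, `c ∈ A` a champion of `w` (`I_w(a) ≤ I_w(c)` for `a ∈ A`), and suppose every positive-weight pair leaving
`S` ends in `y` or `z` (`y ≠ z`, both outside `S`).  Let `K` be the configuration off `S`.  If for every champion `x`
of `K` set-champion stability `CS_K(T, x)` holds at the three observer sets `T = {y}, {z}, {y, z}` (read off
`ξ(ω) = ω ∩ {e | ∀ v ∈ S, v ∉ e}`), then `CS_w(S, c)`:
`μ(c ↮ S, 1 ≤ |π(S)| ≤ j) ≤ μ(c ↮ S, |π(c)| ≤ j)`.  (Crux notes BLOBQUOTIENT.md §20; the hypotheses at `T` are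
instances of set-champion stability for a weight function with fewer positive pairs — the induction hypothesis of
`setCS_of_step` — or, when `T` contains a relay, of the lonely-cluster exchange.) [folklore] -/
theorem setCS_of_twoGate (w : Sym2 (Fin n) → unitInterval) (A S : Finset (Fin n)) (c y z : Fin n) (j : ℕ)
    (hSA : Disjoint S A) (hcA : c ∈ A) (hyz : y ≠ z) (hyS : y ∉ S) (hzS : z ∉ S)
    (hsupp : ∀ v ∈ S, ∀ u, u ∉ S → w s(v, u) ≠ 0 → u = y ∨ u = z)
    (hchamp : ∀ a ∈ A,
      (prodBernoulli w).real {ω : BondConfig (Fin n) | (A.filter fun b => ω ∈ openConn a b).card ≤ j} ≤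
        (prodBernoulli w).real {ω : BondConfig (Fin n) | (A.filter fun b => ω ∈ openConn c b).card ≤ j})
    (hK : ∀ x ∈ A,
      (∀ a ∈ A,
        (prodBernoulli w).real {ω : BondConfig (Fin n) |
            (A.filter fun b => (openGraph (ω ∩ {e | ∀ v ∈ S, v ∉ e})).Reachable a b).card ≤ j} ≤
          (prodBernoulli w).real {ω : BondConfig (Fin n) |
            (A.filter fun b => (openGraph (ω ∩ {e | ∀ v ∈ S, v ∉ e})).Reachable x b).card ≤ j}) →
      ∀ T ∈ ({{y}, {z}, {y, z}} : Finset (Finset (Fin n))),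
        (prodBernoulli w).real {ω : BondConfig (Fin n) |
            (∀ u ∈ T, ¬ (openGraph (ω ∩ {e | ∀ v ∈ S, v ∉ e})).Reachable x u) ∧
              1 ≤ (A.filter fun b => ∃ u ∈ T, (openGraph (ω ∩ {e | ∀ v ∈ S, v ∉ e})).Reachable u b).card ∧
              (A.filter fun b => ∃ u ∈ T, (openGraph (ω ∩ {e | ∀ v ∈ S, v ∉ e})).Reachable u b).card ≤ j} ≤
          (prodBernoulli w).real {ω : BondConfig (Fin n) |
            (∀ u ∈ T, ¬ (openGraph (ω ∩ {e | ∀ v ∈ S, v ∉ e})).Reachable x u) ∧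
              (A.filter fun b => (openGraph (ω ∩ {e | ∀ v ∈ S, v ∉ e})).Reachable x b).card ≤ j}) :
    (prodBernoulli w).real {ω : BondConfig (Fin n) | (∀ x ∈ S, ω ∉ openConn c x) ∧
        1 ≤ (A.filter fun b => ∃ x ∈ S, ω ∈ openConn x b).card ∧
        (A.filter fun b => ∃ x ∈ S, ω ∈ openConn x b).card ≤ j} ≤
      (prodBernoulli w).real {ω : BondConfig (Fin n) | (∀ x ∈ S, ω ∉ openConn c x) ∧
        (A.filter fun b => ω ∈ openConn c b).card ≤ j} := by
  haveI : IsProbabilityMeasure (prodBernoulli w) := inferInstance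
  set μ := prodBernoulli w with hμ
  have hcS : c ∉ S := fun h => Finset.disjoint_left.1 hSA h hcA
  -- the events of the conclusion
  set LS := {ω : BondConfig (Fin n) | (∀ x ∈ S, ω ∉ openConn c x) ∧
    1 ≤ (A.filter fun b => ∃ x ∈ S, ω ∈ openConn x b).card ∧
    (A.filter fun b => ∃ x ∈ S, ω ∈ openConn x b).card ≤ j} with hLS
  set RS := {ω : BondConfig (Fin n) | (∀ x ∈ S, ω ∉ openConn c x) ∧
    (A.filter fun b => ω ∈ openConn c b).card ≤ j} with hRS
  -- the quantities of the flat expansion (all read off `ξ(ω)`)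
  set q : Finset (Fin n) → ℝ := fun Y =>
    μ.real {ω : BondConfig (Fin n) | (Finset.univ.filter fun u => u ∉ S ∧ ∃ v ∈ S, s(u, v) ∈ ω) = Y} with hq
  set ℓ : Finset (Fin n) → Fin n → ℝ := fun Y x => μ.real {ω : BondConfig (Fin n) |
    (∀ u ∈ Y, ¬ (openGraph (ω ∩ {e | ∀ v ∈ S, v ∉ e})).Reachable x u) ∧
      1 ≤ (A.filter fun b => ∃ u ∈ Y, (openGraph (ω ∩ {e | ∀ v ∈ S, v ∉ e})).Reachable u b).card ∧
      (A.filter fun b => ∃ u ∈ Y, (openGraph (ω ∩ {e | ∀ v ∈ S, v ∉ e})).Reachable u b).card ≤ j} with hℓ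
  set r : Finset (Fin n) → Fin n → ℝ := fun Y x => μ.real {ω : BondConfig (Fin n) |
    (∀ u ∈ Y, ¬ (openGraph (ω ∩ {e | ∀ v ∈ S, v ∉ e})).Reachable x u) ∧
      (A.filter fun b => (openGraph (ω ∩ {e | ∀ v ∈ S, v ∉ e})).Reachable x b).card ≤ j} with hr
  set bb : Finset (Fin n) → Fin n → ℝ := fun Y x => μ.real {ω : BondConfig (Fin n) |
    (∃ u ∈ Y, (openGraph (ω ∩ {e | ∀ v ∈ S, v ∉ e})).Reachable x u) ∧
      (A.filter fun b => ∃ u ∈ Y, (openGraph (ω ∩ {e | ∀ v ∈ S, v ∉ e})).Reachable u b).card ≤ j} with hbb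
  set bad : Finset (Fin n) → ℝ := fun Y => μ.real {ω : BondConfig (Fin n) |
    1 ≤ (A.filter fun b => ∃ u ∈ Y, (openGraph (ω ∩ {e | ∀ v ∈ S, v ∉ e})).Reachable u b).card ∧
      (A.filter fun b => ∃ u ∈ Y, (openGraph (ω ∩ {e | ∀ v ∈ S, v ∉ e})).Reachable u b).card ≤ j} with hbad
  set IK : Fin n → ℝ := fun x => μ.real {ω : BondConfig (Fin n) |
    (A.filter fun b => (openGraph (ω ∩ {e | ∀ v ∈ S, v ∉ e})).Reachable x b).card ≤ j} with hIK
  set θ : ℝ := μ.real {ω : BondConfig (Fin n) | (openGraph (ω ∩ {e | ∃ v ∈ S, v ∈ e})).Reachable y z} with hθ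
  set 𝒴 : Finset (Finset (Fin n)) := ({y, z} : Finset (Fin n)).powerset with h𝒴def
  have h𝒴 : μ.real {ω : BondConfig (Fin n) |
      (Finset.univ.filter fun u => u ∉ S ∧ ∃ v ∈ S, s(u, v) ∈ ω) ∉ 𝒴} = 0 :=
    measureReal_gate_not_mem_powerset w S hsupp
  -- flat expansions of both sides
  have hL : μ.real LS = ∑ Y ∈ 𝒴, q Y * ℓ Y c := SetStar.setL_eq_sum w A S c j hSA hcS 𝒴 h𝒴
  have hR : μ.real RS = ∑ Y ∈ 𝒴, q Y * r Y c := SetStar.setR_eq_sum w A S c j hcS 𝒴 h𝒴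
  -- the weights
  have hq1 : ∑ Y ∈ 𝒴, q Y = 1 := by
    have h := SetStar.measureReal_eq_sum_gateEq w S 𝒴 h𝒴 Set.univ
    rw [probReal_univ] at h
    rw [h]
    refine Finset.sum_congr rfl fun Y _ => ?_
    rw [Set.univ_inter]
  have hq0 : ∀ Y ∈ 𝒴, 0 ≤ q Y := fun Y _ => measureReal_nonneg
  have hIK0 : ∀ x, 0 ≤ IK x := fun x => measureReal_nonneg
  have hyz𝒴 : ({y, z} : Finset (Fin n)) ∈ 𝒴 := Finset.mem_powerset.2 (Finset.Subset.refl _)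
  -- a champion of `K`
  obtain ⟨c₀, hc₀A, hc₀max⟩ := Finset.exists_max_image A IK ⟨c, hcA⟩
  -- bookkeeping identities in `K`
  have hshift : ∀ Y, ∀ x ∈ A, ℓ Y x + bb Y x = bad Y := by
    intro Y x hx
    exact setL_add_near w A Y {e | ∀ v ∈ S, v ∉ e} hx j
  have hsing : ∀ u₀ x, r {u₀} x + bb {u₀} x = IK x := by
    intro u₀ x
    exact setR_add_near_singleton w A {e | ∀ v ∈ S, v ∉ e} x u₀ j
  have hℓ0 : ∀ x, ℓ ∅ x = 0 := fun x => setL_empty w A {e | ∀ v ∈ S, v ∉ e} x j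
  have hr0 : ∀ x, r ∅ x = IK x := fun x => setR_empty w A {e | ∀ v ∈ S, v ∉ e} x j
  have hmem3 : ∀ Y ∈ 𝒴, Y ≠ ∅ → Y ∈ ({{y}, {z}, {y, z}} : Finset (Finset (Fin n))) := by
    intro Y hY hne
    rcases subset_pair_cases (Finset.mem_powerset.1 hY) with h | h | h | h
    · exact absurd h hne
    all_goals simp [h]
  by_cases hcK : ∀ a ∈ A, IK a ≤ IK c
  · -- Case 1: `c` is a champion of `K`: every term is nonnegative
    have hKc := hK c hcA hcK
    have hterm : ∀ Y ∈ 𝒴, ℓ Y c ≤ r Y c := by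
      intro Y hY
      by_cases hY0 : Y = ∅
      · rw [hY0, hℓ0, hr0]; exact hIK0 c
      · exact hKc Y (hmem3 Y hY hY0)
    exact (hL.trans_le (sum_le_of_termwise 𝒴 q (fun Y => ℓ Y c) (fun Y => r Y c) hq0 hterm)).trans_eq hR.symm
  · -- Case 2: `c` is not a champion of `K`; reference witness `c₀`
    push Not at hcK
    obtain ⟨a₁, ha₁A, ha₁⟩ := hcK
    have hdK : IK c - IK c₀ < 0 := by linarith [hc₀max a₁ ha₁A]
    have hK₀ := hK c₀ hc₀A hc₀max
    have hmy : ({y} : Finset (Fin n)) ∈ ({{y}, {z}, {y, z}} : Finset (Finset (Fin n))) := by simp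
    have hmz : ({z} : Finset (Fin n)) ∈ ({{y}, {z}, {y, z}} : Finset (Finset (Fin n))) := by simp
    have hmyz : ({y, z} : Finset (Fin n)) ∈ ({{y}, {z}, {y, z}} : Finset (Finset (Fin n))) := by simp
    have hKy : ℓ {y} c₀ ≤ r {y} c₀ := hK₀ {y} hmy
    have hKz : ℓ {z} c₀ ≤ r {z} c₀ := hK₀ {z} hmz
    have hKyz : ℓ {y, z} c₀ ≤ r {y, z} c₀ := hK₀ {y, z} hmyz
    -- per-term bounds
    have hterm : ∀ Y ∈ 𝒴, Y ≠ {y, z} → IK c - IK c₀ ≤ r Y c - ℓ Y c := by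
      intro Y hY hne
      rcases subset_pair_cases (Finset.mem_powerset.1 hY) with h | h | h | h
      · rw [h, hℓ0, hr0]; linarith [hIK0 c₀]
      · rw [h]
        have e1 := hshift {y} c hcA
        have e2 := hshift {y} c₀ hc₀A
        have s1 := hsing y c
        have s2 := hsing y c₀
        linarith
      · rw [h]
        have e1 := hshift {z} c hcA
        have e2 := hshift {z} c₀ hc₀A
        have s1 := hsing z c
        have s2 := hsing z c₀
        linarith
      · exact absurd h hne
    have hY₁term : (r {y, z} c + bb {y, z} c) - (r {y, z} c₀ + bb {y, z} c₀) ≤ r {y, z} c - ℓ {y, z} c := by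
      have e1 := hshift {y, z} c hcA
      have e2 := hshift {y, z} c₀ hc₀A
      linarith
    -- the champion hypothesis along the one-parameter family
    have hlc : μ.real {ω : BondConfig (Fin n) | (A.filter fun b => ω ∈ openConn c b).card ≤ j} =
        θ * (bb {y, z} c + r {y, z} c) + (1 - θ) * IK c := lightness_eq w A S c j hSA hcS hsupp
    have hc₀S : c₀ ∉ S := fun h => Finset.disjoint_left.1 hSA h hc₀A
    have hlc₀ : μ.real {ω : BondConfig (Fin n) | (A.filter fun b => ω ∈ openConn c₀ b).card ≤ j} =
        θ * (bb {y, z} c₀ + r {y, z} c₀) + (1 - θ) * IK c₀ := lightness_eq w A S c₀ j hSA hc₀S hsupp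
    have hch := hchamp c₀ hc₀A
    have hθ0 : 0 ≤ θ := measureReal_nonneg
    have hθρ : θ ≤ q {y, z} := measureReal_R_le_gateEq_pair w S hyz hyS hzS hsupp
    have haff : 0 ≤ (1 - θ) * (IK c - IK c₀) +
        θ * ((r {y, z} c + bb {y, z} c) - (r {y, z} c₀ + bb {y, z} c₀)) := by
      rw [hlc, hlc₀] at hch
      linarith
    have hfinal := affine_mono hdK haff hθ0 hθρ
    exact (hL.trans_le (sum_flat_bound 𝒴 hyz𝒴 q (fun Y => ℓ Y c) (fun Y => r Y c) hq0 hq1 hterm hY₁term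
      hfinal)).trans_eq hR.symm


/-! ### The STEP of `setCS_of_step` for observer sets with at most two gates -/

/-- Transfer of an event read off `ω ∩ D` to the weight function switched off outside `D`. [folklore] -/
theorem measureReal_preimage_off (w : Sym2 (Fin n) → unitInterval) (D : Set (Sym2 (Fin n)))
    [DecidablePred (· ∈ D)] (T : Set (BondConfig (Fin n))) :
    (prodBernoulli w).real {ω : BondConfig (Fin n) | ω ∩ D ∈ T} =
      (prodBernoulli fun e => if e ∈ D then w e else 0).real T := by
  have hmap := prodBernoulli_map_inter w D
  have hproj : Measurable (fun ξ : Set (Sym2 (Fin n)) => ξ ∩ D) :=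
    measurable_set_iff.2 fun i => (measurable_set_mem i).and measurable_const
  have h := Measure.map_apply (μ := prodBernoulli w) hproj (MeasurableSet.of_discrete (s := T))
  rw [hmap] at h
  simp only [measureReal_def]
  rw [h]
  rfl

/-- Membership in `openConn`, as reachability (inside `Finset.filter` the two spellings elaborate different
`Decidable` instances; `simp only [mem_openConn_iff']` converts one into the other). [folklore] -/
theorem mem_openConn_iff' (ξ : BondConfig (Fin n)) (x y : Fin n) :
    ξ ∈ openConn x y ↔ (openGraph ξ).Reachable x y := Iff.rfl

/-- **The STEP holds for observer sets with at most two gates.**  In the setting of `setCS_of_step`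
(`…CILInductionStep`): if `S` is disjoint from `A`, `c ∈ A` is a champion of `w`, some positive-weight pair leaves `S`,
every positive-weight pair leaving `S` ends in `y` or `z` (`y ≠ z` outside `S`), and set-champion stability holds for
every champion of every weight function of smaller measure
`μ(w') < μ(w) = (|Sym2 (Fin n)| + 1)·#{w ≠ 0} + #{0 < w < 1}` at every nonempty observer set disjoint from `A`, then
`CS_w(S, c)`.  (Neither the lightness of `S`, nor `2 ≤ |S|`, nor the non-adjacency of `c` is needed here; the weight
function `w^S` = `w` switched off on the pairs meeting `S` has smaller measure, its champions get `CS` at `{y}`, `{z}`,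
`{y,z}` from the hypothesis or — when the set contains a relay — from the lonely-cluster exchange, and
`setCS_of_twoGate` applies.) [folklore] -/
theorem step_of_twoGate (w : Sym2 (Fin n) → unitInterval) (A S : Finset (Fin n)) (c y z : Fin n) (j : ℕ)
    (hSA : Disjoint S A) (hcA : c ∈ A) (hyz : y ≠ z) (hyS : y ∉ S) (hzS : z ∉ S)
    (hsupp : ∀ v ∈ S, ∀ u, u ∉ S → w s(v, u) ≠ 0 → u = y ∨ u = z)
    (hchamp : ∀ a ∈ A,
      (prodBernoulli w).real {ω : BondConfig (Fin n) | (A.filter fun b => ω ∈ openConn a b).card ≤ j} ≤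
        (prodBernoulli w).real {ω : BondConfig (Fin n) | (A.filter fun b => ω ∈ openConn c b).card ≤ j})
    (hout : ∃ v ∈ S, ∃ u, u ∉ S ∧ w s(v, u) ≠ 0)
    (ih : ∀ w' : Sym2 (Fin n) → unitInterval,
      (Fintype.card (Sym2 (Fin n)) + 1) * (Finset.univ.filter fun e => w' e ≠ 0).card +
          (Finset.univ.filter fun e => w' e ≠ 0 ∧ w' e ≠ 1).card <
        (Fintype.card (Sym2 (Fin n)) + 1) * (Finset.univ.filter fun e => w e ≠ 0).card +
          (Finset.univ.filter fun e => w e ≠ 0 ∧ w e ≠ 1).card →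
      ∀ (T : Finset (Fin n)) (x : Fin n), Disjoint T A → T.Nonempty → x ∈ A →
      (∀ a ∈ A, (prodBernoulli w').real {ω : BondConfig (Fin n) | (A.filter fun b => ω ∈ openConn a b).card ≤ j} ≤
        (prodBernoulli w').real {ω : BondConfig (Fin n) | (A.filter fun b => ω ∈ openConn x b).card ≤ j}) →
      (prodBernoulli w').real {ω : BondConfig (Fin n) | (∀ u ∈ T, ω ∉ openConn x u) ∧
          1 ≤ (A.filter fun b => ∃ u ∈ T, ω ∈ openConn u b).card ∧
          (A.filter fun b => ∃ u ∈ T, ω ∈ openConn u b).card ≤ j} ≤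
        (prodBernoulli w').real {ω : BondConfig (Fin n) | (∀ u ∈ T, ω ∉ openConn x u) ∧
          (A.filter fun b => ω ∈ openConn x b).card ≤ j}) :
    (prodBernoulli w).real {ω : BondConfig (Fin n) | (∀ x ∈ S, ω ∉ openConn c x) ∧
        1 ≤ (A.filter fun b => ∃ x ∈ S, ω ∈ openConn x b).card ∧
        (A.filter fun b => ∃ x ∈ S, ω ∈ openConn x b).card ≤ j} ≤
      (prodBernoulli w).real {ω : BondConfig (Fin n) | (∀ x ∈ S, ω ∉ openConn c x) ∧
        (A.filter fun b => ω ∈ openConn c b).card ≤ j} := by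
  -- the weight function switched off on the pairs meeting `S`, and its smaller measure
  obtain ⟨v₀, hv₀S, u₀, -, hwu₀⟩ := hout
  have he₀D : s(v₀, u₀) ∉ {e : Sym2 (Fin n) | ∀ v ∈ S, v ∉ e} := fun h => h v₀ hv₀S (Sym2.mem_mk_left v₀ u₀)
  have hnz : (Finset.univ.filter fun e => (fun e => if e ∈ {e : Sym2 (Fin n) | ∀ v ∈ S, v ∉ e} then w e else 0) e ≠ 0) ⊆
      (Finset.univ.filter fun e => w e ≠ 0).erase s(v₀, u₀) := by
    intro e he
    rw [Finset.mem_filter] at he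
    rw [Finset.mem_erase, Finset.mem_filter]
    by_cases heD : e ∈ {e : Sym2 (Fin n) | ∀ v ∈ S, v ∉ e}
    · simp only [heD, if_true] at he
      exact ⟨fun h => he₀D (h ▸ heD), Finset.mem_univ _, he.2⟩
    · simp [heD] at he
  have hfr : (Finset.univ.filter fun e =>
        (fun e => if e ∈ {e : Sym2 (Fin n) | ∀ v ∈ S, v ∉ e} then w e else 0) e ≠ 0 ∧
          (fun e => if e ∈ {e : Sym2 (Fin n) | ∀ v ∈ S, v ∉ e} then w e else 0) e ≠ 1) ⊆
      (Finset.univ.filter fun e => w e ≠ 0 ∧ w e ≠ 1) := by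
    intro e he
    rw [Finset.mem_filter] at he ⊢
    by_cases heD : e ∈ {e : Sym2 (Fin n) | ∀ v ∈ S, v ∉ e}
    · simp only [heD, if_true] at he
      exact ⟨Finset.mem_univ _, he.2⟩
    · simp [heD] at he
  have hlt : (Fintype.card (Sym2 (Fin n)) + 1) *
        (Finset.univ.filter fun e =>
          (fun e => if e ∈ {e : Sym2 (Fin n) | ∀ v ∈ S, v ∉ e} then w e else 0) e ≠ 0).card +
        (Finset.univ.filter fun e =>
          (fun e => if e ∈ {e : Sym2 (Fin n) | ∀ v ∈ S, v ∉ e} then w e else 0) e ≠ 0 ∧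
            (fun e => if e ∈ {e : Sym2 (Fin n) | ∀ v ∈ S, v ∉ e} then w e else 0) e ≠ 1).card <
      (Fintype.card (Sym2 (Fin n)) + 1) * (Finset.univ.filter fun e => w e ≠ 0).card +
        (Finset.univ.filter fun e => w e ≠ 0 ∧ w e ≠ 1).card := by
    have h1 := Finset.card_le_card hnz
    have hmem : s(v₀, u₀) ∈ (Finset.univ.filter fun e => w e ≠ 0) :=
      Finset.mem_filter.2 ⟨Finset.mem_univ _, hwu₀⟩
    rw [Finset.card_erase_of_mem hmem] at h1
    have hpos := Finset.card_pos.2 ⟨_, hmem⟩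
    have h2 := Finset.card_le_card hfr
    have h3 : (Finset.univ.filter fun e =>
        (fun e => if e ∈ {e : Sym2 (Fin n) | ∀ v ∈ S, v ∉ e} then w e else 0) e ≠ 0).card + 1 ≤
        (Finset.univ.filter fun e => w e ≠ 0).card := by
      omega
    have h4 := Nat.mul_le_mul_left (Fintype.card (Sym2 (Fin n)) + 1) h3
    rw [Nat.mul_add, Nat.mul_one] at h4
    generalize hP : (Fintype.card (Sym2 (Fin n)) + 1) * (Finset.univ.filter fun e =>
        (fun e => if e ∈ {e : Sym2 (Fin n) | ∀ v ∈ S, v ∉ e} then w e else 0) e ≠ 0).card = P at h4 ⊢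
    generalize hQ : (Fintype.card (Sym2 (Fin n)) + 1) * (Finset.univ.filter fun e => w e ≠ 0).card = Q at h4 ⊢
    omega
  -- transfer of the lightness events to the switched-off weight function
  have hI : ∀ t : Fin n,
      (prodBernoulli w).real {ω : BondConfig (Fin n) |
          (A.filter fun b => (openGraph (ω ∩ {e | ∀ v ∈ S, v ∉ e})).Reachable t b).card ≤ j} =
        (prodBernoulli fun e => if e ∈ {e : Sym2 (Fin n) | ∀ v ∈ S, v ∉ e} then w e else 0).real
          {ω : BondConfig (Fin n) | (A.filter fun b => ω ∈ openConn t b).card ≤ j} := by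
    intro t
    have h := measureReal_preimage_off w {e : Sym2 (Fin n) | ∀ v ∈ S, v ∉ e}
      {ω : BondConfig (Fin n) | (A.filter fun b => ω ∈ openConn t b).card ≤ j}
    have hset : {ω : BondConfig (Fin n) | ω ∩ {e : Sym2 (Fin n) | ∀ v ∈ S, v ∉ e} ∈
        {ω : BondConfig (Fin n) | (A.filter fun b => ω ∈ openConn t b).card ≤ j}} =
        {ω : BondConfig (Fin n) |
          (A.filter fun b => (openGraph (ω ∩ {e | ∀ v ∈ S, v ∉ e})).Reachable t b).card ≤ j} := by
      ext ω; simp only [mem_setOf_eq, mem_openConn_iff']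
    rw [hset] at h
    exact h
  refine setCS_of_twoGate w A S c y z j hSA hcA hyz hyS hzS hsupp hchamp ?_
  intro x hxA hxmax T hT
  have hxmax' : ∀ a ∈ A,
      (prodBernoulli fun e => if e ∈ {e : Sym2 (Fin n) | ∀ v ∈ S, v ∉ e} then w e else 0).real
          {ω : BondConfig (Fin n) | (A.filter fun b => ω ∈ openConn a b).card ≤ j} ≤
        (prodBernoulli fun e => if e ∈ {e : Sym2 (Fin n) | ∀ v ∈ S, v ∉ e} then w e else 0).real
          {ω : BondConfig (Fin n) | (A.filter fun b => ω ∈ openConn x b).card ≤ j} := by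
    intro a ha
    rw [← hI a, ← hI x]
    exact hxmax a ha
  have hL := measureReal_preimage_off w {e : Sym2 (Fin n) | ∀ v ∈ S, v ∉ e}
    {ω : BondConfig (Fin n) | (∀ u ∈ T, ω ∉ openConn x u) ∧
      1 ≤ (A.filter fun b => ∃ u ∈ T, ω ∈ openConn u b).card ∧
      (A.filter fun b => ∃ u ∈ T, ω ∈ openConn u b).card ≤ j}
  have hsetL : {ω : BondConfig (Fin n) | ω ∩ {e : Sym2 (Fin n) | ∀ v ∈ S, v ∉ e} ∈
      {ω : BondConfig (Fin n) | (∀ u ∈ T, ω ∉ openConn x u) ∧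
        1 ≤ (A.filter fun b => ∃ u ∈ T, ω ∈ openConn u b).card ∧
        (A.filter fun b => ∃ u ∈ T, ω ∈ openConn u b).card ≤ j}} =
      {ω : BondConfig (Fin n) |
        (∀ u ∈ T, ¬ (openGraph (ω ∩ {e | ∀ v ∈ S, v ∉ e})).Reachable x u) ∧
          1 ≤ (A.filter fun b => ∃ u ∈ T, (openGraph (ω ∩ {e | ∀ v ∈ S, v ∉ e})).Reachable u b).card ∧
          (A.filter fun b => ∃ u ∈ T, (openGraph (ω ∩ {e | ∀ v ∈ S, v ∉ e})).Reachable u b).card ≤ j} := by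
    ext ω; simp only [mem_setOf_eq, mem_openConn_iff']
  rw [hsetL] at hL
  have hR := measureReal_preimage_off w {e : Sym2 (Fin n) | ∀ v ∈ S, v ∉ e}
    {ω : BondConfig (Fin n) | (∀ u ∈ T, ω ∉ openConn x u) ∧ (A.filter fun b => ω ∈ openConn x b).card ≤ j}
  have hsetR : {ω : BondConfig (Fin n) | ω ∩ {e : Sym2 (Fin n) | ∀ v ∈ S, v ∉ e} ∈
      {ω : BondConfig (Fin n) | (∀ u ∈ T, ω ∉ openConn x u) ∧ (A.filter fun b => ω ∈ openConn x b).card ≤ j}} =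
      {ω : BondConfig (Fin n) |
        (∀ u ∈ T, ¬ (openGraph (ω ∩ {e | ∀ v ∈ S, v ∉ e})).Reachable x u) ∧
          (A.filter fun b => (openGraph (ω ∩ {e | ∀ v ∈ S, v ∉ e})).Reachable x b).card ≤ j} := by
    ext ω; simp only [mem_setOf_eq, mem_openConn_iff']
  rw [hsetR] at hR
  rw [hL, hR]
  by_cases hTA : Disjoint T A
  · have hTne : T.Nonempty := by
      simp only [Finset.mem_insert, Finset.mem_singleton] at hT
      rcases hT with rfl | rfl | rfl
      · exact Finset.singleton_nonempty _
      · exact Finset.singleton_nonempty _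
      · exact Finset.insert_nonempty _ _
    exact ih _ hlt T x hTA hTne hxA hxmax'
  · rw [Finset.not_disjoint_iff] at hTA
    obtain ⟨a, haT, haA⟩ := hTA
    convert observerSet_le_of_lonelier (fun e => if e ∈ {e : Sym2 (Fin n) | ∀ v ∈ S, v ∉ e} then w e else 0)
      A T a x haT j (hxmax' a haA) using 12

end TwoGate

end CutObserver

end Summit.CriticalPhenomena.PercolationContinuityZ3.Theorems

end
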